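import Summits.RiemannHypothesis.RiemannHypothesis.Theses.UniversalFactor
import Literature.NumberTheory.LFunctions.RiemannSiegel

/-!
# Line `pencil-bracket-count` — crux `UniversalFactor.MediumKernelNoGo` (stmt-RiemannHypothesis-2577)

Skeleton (crux-plan, round 1; planner-cruxplan-stmt-RiemannHypothesis-2577-pencil-bracket-count-0).
Crux: `∀ a, π/8 ≤ a → a ≤ 32 → ¬ HasOnlyRealZeros F_a`, where
`F_a = deBruijnHDiv (fun u ↦ 1 + u²/a²)` is the Laplace(a)-smoothing
`F_a(x) = (a/2)∫ H_0(x−y) e^{−a|y|} dy` of `H_0 = deBruijnH 0 = ξ(1/2 + ix/2)/8` (the crux inlines the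
cosine integral, which IS `deBruijnHDiv …` by `rfl`).

THE LINE. Two real segments decide the whole window `a ∈ [π/8, 32]`:
* LEVER `stub_zeroFreeBracket` (card K1, PROVED contour-free in
  `Cruxes/MediumKernelNoGo/TRIAGE_r1_1_ZeroFreeBracket.lean`): a SAME-SIGN BRACKET — `σF_a > 0` on `[c,d]`,
  `σH_0(c) > 0`, `σH_0(d) > 0`, `σH_0(m) ≤ 0` for some `c < m < d` (a critical zero of `ζ` swallowed by the
  smoothing) — forces a non-real zero of `F_a` (least touching parameter of the Laguerre pencil
  `G_s = (1−s)F_a + sH_0 = (1 − D²/b²)F_a`, then `touching_false`). Uses `0 < a` (Disproof.lean §2 honoured).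
* LINK `stub_hardyLink`: `H_0(2t) = −A(t)·Z(t)` with `A(t) > 0` (`A = (t²+¼)π^{−1/4}‖Γ(¼+it/2)‖/16`), so every
  sign of `H_0` on the real axis is a sign of Hardy's `Z`, certified by the tree's `hardyZ_pos_of_re_pos` /
  `hardyZ_neg_of_re_neg` (HardyZSignCertificate.lean).
* LOW WINDOW `a ∈ [π/8, 1]`: ONE bracket around the close pair `γ₃₄ = 111.0295`, `γ₃₅ = 111.8747`
  (`x = 2γ ∈ [222.059, 223.749]`, a small POSITIVE hump of `H_0` drowned by the smoothing):
  `stub_lowSigns` (`Z(110.95) > 0`, `Z(111.95) > 0`, `Z ≤ 0` in between) and `stub_lowBox`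
  (`F_a < 0` on `[π/8, 1] × [221.9, 223.9]`; planner's atlas j013501/j013808: normalised margin
  `−F_a/S_a ≥ 0.170` on the whole box (`0.170` at `a = π/8` exactly, `≥ 0.30` from `a = 0.405`, `0.71` at `a = 1`),
  `S_a` = the same smoothing of `|H_0|`; still `0.44` at `a = 1.3`).
* LEHMER WINDOW `a ∈ [1, 32]`: ONE bracket around Lehmer's pair `γ₆₇₀₉ = 7005.0629`, `γ₆₇₁₀ = 7005.1006`
  (`x ∈ [14010.126, 14010.201]`, a NEGATIVE dip of `H_0` filled by the variance `2/a²` for `a < 2√2/g = 37.5`):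
  `stub_lehmerSigns` (`Z(7004.915) < 0`, `Z(7005.25) < 0`, `Z ≥ 0` in between) and `stub_lehmerBox`
  (`F_a > 0` on `[1, 32] × [14009.83, 14010.5]`; three independent Arb/mpmath atlases: valid for every sampled
  `a ∈ [0.5, 37.25]`, first failure `a = 37.5 = 2√2/g`; margin `min F_a / hump = 7.9e-2 (a=1) … 1.9e-4 (a=32)`).
`MediumKernelNoGo_of` composes the six registered stubs into the crux BY NAME (case split at `a = 1`;
pure logic + `0 < A`; no `sorry`); the `example` after it is the wiring check with the `stub_*` theorems.
-/

noncomputable section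

open Set
open Literature.NumberTheory.LFunctions

namespace Summit.RiemannHypothesis.RiemannHypothesis.Cruxes.MediumKernelNoGo.PencilBracketCount

/-! ## The six statements (named; each is VERBATIM the signature of its `stub_*` theorem below) -/

/-- Statement of `stub_zeroFreeBracket` (the lever, card K1). -/
def ZeroFreeBracket : Prop :=
  ∀ (a c m d σ : ℝ), 0 < a → c < m → m < d → (σ = 1 ∨ σ = -1) →
    (∀ x ∈ Icc c d, 0 < σ * (deBruijnHDiv (fun u : ℝ => 1 + u ^ 2 / a ^ 2) (x : ℂ)).re) →
    0 < σ * (deBruijnH 0 (c : ℂ)).re → 0 < σ * (deBruijnH 0 (d : ℂ)).re → σ * (deBruijnH 0 (m : ℂ)).re ≤ 0 →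
    ¬ HasOnlyRealZeros (deBruijnHDiv fun u : ℝ => 1 + u ^ 2 / a ^ 2)

/-- Statement of `stub_hardyLink` (sign-level link `H_0(2t) = −A(t) Z(t)`, `A(t) > 0`). -/
def HardyLink : Prop :=
  ∀ t : ℝ, ∃ A : ℝ, 0 < A ∧ (deBruijnH 0 ((2 * t : ℝ) : ℂ)).re = -(A * hardyZ t)

/-- Statement of `stub_lowSigns` (three signs of `Z` at `t ≈ 111`). -/
def LowSigns : Prop :=
  0 < hardyZ 110.95 ∧ 0 < hardyZ 111.95 ∧ ∃ t : ℝ, 110.95 < t ∧ t < 111.95 ∧ hardyZ t ≤ 0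

/-- Statement of `stub_lowBox` (`F_a < 0` on `[π/8, 1] × [221.9, 223.9]`). -/
def LowBox : Prop :=
  ∀ a : ℝ, Real.pi / 8 ≤ a → a ≤ 1 → ∀ x ∈ Icc (221.9 : ℝ) 223.9,
    (deBruijnHDiv (fun u : ℝ => 1 + u ^ 2 / a ^ 2) (x : ℂ)).re < 0

/-- Statement of `stub_lehmerSigns` (three signs of `Z` at Lehmer's pair, `t ≈ 7005`). -/
def LehmerSigns : Prop :=
  hardyZ 7004.915 < 0 ∧ hardyZ 7005.25 < 0 ∧ ∃ t : ℝ, 7004.915 < t ∧ t < 7005.25 ∧ 0 ≤ hardyZ t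

/-- Statement of `stub_lehmerBox` (`F_a > 0` on `[1, 32] × [14009.83, 14010.5]`). -/
def LehmerBox : Prop :=
  ∀ a : ℝ, 1 ≤ a → a ≤ 32 → ∀ x ∈ Icc (14009.83 : ℝ) 14010.5,
    0 < (deBruijnHDiv (fun u : ℝ => 1 + u ^ 2 / a ^ 2) (x : ℂ)).re

/-! ## Registered stubs (`sorry` lives ONLY here) -/

/-- **STUB 1 — `ZeroFreeBracket`, the lever (card K1; size M; PROOF IN HAND).** For `a > 0`, `c < m < d`,
`σ = ±1`: if `σ·Re F_a > 0` on `[c,d]`, `σ·Re H_0(c) > 0`, `σ·Re H_0(d) > 0` and `σ·Re H_0(m) ≤ 0`, then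
`F_a` has a non-real zero. Proof (to land verbatim under `Theorems/`): `TriageTouching.zeroFreeBracket` in
`Cruxes/MediumKernelNoGo/TRIAGE_r1_1_ZeroFreeBracket.lean` (rc 0, 0 sorry; imports
UniversalFactorLaplaceLoopholeInterlacing / LaguerreLift / SignCriterion): least parameter `s*` of the compact set
`{(s,x) ∈ [0,1]×[c,d] : σ((1−s)F_a + sH_0)(x) ≤ 0}` gives an interior zero-and-minimum of
`G = F_a − (s*/a²)F_a″`, i.e. `F″ = b²F`, `F‴ = b²F′` at `x*` with `F(x*) ≠ 0`, which `touching_false` forbids under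
`HasOnlyRealZeros F_a` (Laguerre steps `F′ ± bF`, `(f′/f)′ ≤ −1/|x−a₀|²`, evenness). -/
theorem stub_zeroFreeBracket :
    ∀ (a c m d σ : ℝ), 0 < a → c < m → m < d → (σ = 1 ∨ σ = -1) →
    (∀ x ∈ Icc c d, 0 < σ * (deBruijnHDiv (fun u : ℝ => 1 + u ^ 2 / a ^ 2) (x : ℂ)).re) →
    0 < σ * (deBruijnH 0 (c : ℂ)).re → 0 < σ * (deBruijnH 0 (d : ℂ)).re → σ * (deBruijnH 0 (m : ℂ)).re ≤ 0 →
    ¬ HasOnlyRealZeros (deBruijnHDiv fun u : ℝ => 1 + u ^ 2 / a ^ 2) := by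
  sorry

/-- **STUB 2 — `HardyLink` (size S–M; provable now).** `H_0(2t) = −A(t)·Z(t)` with
`A(t) = (t² + 1/4) π^{−1/4} ‖Γ(1/4 + it/2)‖ / 16 > 0`: from `deBruijnH_zero_eq_holds`
(`H_0(z) = ξ(1/2 + iz/2)/8`), `riemannXi_eq_mul_completedRiemannZeta` (`ξ(s) = ½s(s−1)Λ(s)`, `s = ½ + it ≠ 0, 1`),
`Λ = Γ_ℝ · ζ` with `Gammaℝ_half_add_mul_I`, the phase identity `cexp_riemannSiegelTheta_mul_I_holds`
(`e^{iθ} = π^{−it/2}Γ(¼+it/2)/‖Γ(¼+it/2)‖`) and `ofReal_hardyZ_holds`; positivity of `A` from `Complex.Gamma_ne_zero`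
on `Re s > 0`. Only the SIGN level (`∃ A > 0`) is registered, so no constant can be misstated. -/
theorem stub_hardyLink :
    ∀ t : ℝ, ∃ A : ℝ, 0 < A ∧ (deBruijnH 0 ((2 * t : ℝ) : ℂ)).re = -(A * hardyZ t) := by
  sorry

/-- **STUB 3 — `LowSigns` (size M; certified computation at `t ≈ 111`).** `Z > 0` at `t = 110.95` and
`t = 111.95` and `Z ≤ 0` somewhere in between: the ordinates `γ₃₃ = 107.17 < 110.95 < γ₃₄ = 111.0295 <
γ₃₅ = 111.8747 < 111.95 < γ₃₆ = 114.32` (sign of `Z` on `(γ_n, γ_{n+1})` is `(−1)^{n+1}`). Route: two validated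
values `Re(e^{iφ}ζ(½+it))` with `|φ − θ(t)| < π/2` (`hardyZ_pos_of_re_pos`,
`abs_sub_riemannSiegelTheta_lt_of_stirling`, Euler–Maclaurin `ζ` as in the Mertens / RH-to-101 certificates)
and one at, e.g., `t = 111.45` (or existence from the certified zero `γ₃₄`). -/
theorem stub_lowSigns :
    0 < hardyZ 110.95 ∧ 0 < hardyZ 111.95 ∧ ∃ t : ℝ, 110.95 < t ∧ t < 111.95 ∧ hardyZ t ≤ 0 := by
  sorry

/-- **STUB 4 — `LowBox` (size M–L; certified computation at height `x ≤ 224`, INCLUDING the endpoint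
`a = π/8`).** For every `a ∈ [π/8, 1]` and `x ∈ [221.9, 223.9]`: `F_a(x) < 0` — the Laplace(a)-smoothing drowns
the small positive hump of `H_0` between `2γ₃₄ = 222.059` and `2γ₃₅ = 223.749`. Planner atlas (kit j013501 /
j013808, mpmath dps 25, grid `Δa = 0.005`, `Δx = 0.02`): `−F_a(x)/S_a(x) ≥ 0.170` on the box (`S_a` = same smoothing
of `|H_0|`; minimum `0.170` AT the endpoint `a = π/8`, `≥ 0.30` from `a = 0.405`, `0.85` at `a ≈ 0.68`, `0.71` at `a = 1`),
still `0.44` at `a = 1.3`; at `a = π/8` the profile `F/S ≈ −0.170` is flat across `[221.5, 224.3]` (the undamped past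
dominates). Devices: `F_a = (a/2)(P + Q)` with the one-sided averages of
`UniversalFactor.deBruijnHDiv_laplace_eq_half_mul_add`; `a`-boxes by the monotone enclosure
`∫(H⁺e^{−a₂y} − H⁻e^{−a₁y}) ≤ P_a ≤ ∫(H⁺e^{−a₁y} − H⁻e^{−a₂y})` (`a₁ ≤ a ≤ a₂`, `H_0 = H⁺ − H⁻`); `x`-boxes
by `F_a′ = (a²/2)(Q − P)`; at `a₁ = π/8` the backward window `H_0(x−y)e^{−ay}` is undamped
(`≍ e^{−πx/8}·∫₀ˣ|…|`), so the quadrature runs over the whole `[0, x]` (finite: `x ≤ 224`) plus the tail bound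
`|H_0| ≤ H_0(0)` (`UniversalFactor.norm_deBruijnH_zero_ofReal_le`) beyond. `H_0` on `[0, 300]` from `Z` via
`stub_hardyLink`'s identity (quantitative form) or directly from `∫Φ cos`. -/
theorem stub_lowBox :
    ∀ a : ℝ, Real.pi / 8 ≤ a → a ≤ 1 → ∀ x ∈ Icc (221.9 : ℝ) 223.9,
    (deBruijnHDiv (fun u : ℝ => 1 + u ^ 2 / a ^ 2) (x : ℂ)).re < 0 := by
  sorry

/-- **STUB 5 — `LehmerSigns` (size M–L; certified computation at `t ≈ 7005`).** `Z < 0` at `t = 7004.915`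
and `t = 7005.25`, `Z ≥ 0` somewhere in between: ordinates `γ₆₇₀₈ = 7004.0437 < 7004.915 < γ₆₇₀₉ = 7005.0629
< γ₆₇₁₀ = 7005.1006 < 7005.25 < γ₆₇₁₁ = 7006.7397`, `N(7005.08) = 6709` (planner atlas j013501; Lehmer 1956).
Same route as STUB 3 with `N ≈ 1.2·10³` Euler–Maclaurin terms (or a certified Riemann–Siegel remainder); the
middle sign at `t = 7005.08` needs relative accuracy `~10⁻⁴` of `|Z|` (dip depth `5·10⁻⁴` of the hump) — or
replace it by the EXISTENCE of a zero in `(7004.915, 7005.25)` from an exact zero count (Turing's method,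
`TuringMethod*.lean`). -/
theorem stub_lehmerSigns :
    hardyZ 7004.915 < 0 ∧ hardyZ 7005.25 < 0 ∧ ∃ t : ℝ, 7004.915 < t ∧ t < 7005.25 ∧ 0 ≤ hardyZ t := by
  sorry

/-- **STUB 6 — `LehmerBox` (size L–XL; THE HARDEST STUB; certified computation at height `x ≈ 14010`).**
For every `a ∈ [1, 32]` and `x ∈ [14009.83, 14010.5]`: `F_a(x) > 0` — the variance `2/a²` of Laplace(a) fills
Lehmer's dip (`x`-gap `g = 0.0754`, depth `−5.2·10⁻⁴` of the flanking humps) for every `a < 2√2/g = 37.5`.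
Atlases (ideator j005080 Arb; triage j012419 Arb; planner j013714 mpmath, `Δa = 0.25`): bracket valid at every sampled
`a ∈ [0.5, 37.25]`, first failure `a = 37.5`; `min_{[c,d]} F_a / hump = 7.9e-2 (a=1), 2.3e-3 (16), 1.9e-4 (32), 4.4e-5
(36)`; in local units `min_{[c,d]} F_a/S_a = 0.46 (a=1), 0.98 (4), 0.87 (16), 0.26 (32), 0.07 (36)`, `S_a` = same
smoothing of `|H_0|`; `min F_a/|H_0(mid)| = 0.376` at `a = 32`. Devices as in STUB 4 (here both windows are damped: `a ≥ 1 > π/8`, so `|y| ≤ 60` suffices with the tail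
bound `|H_0| ≤ H_0(0)`… NO: at `x ≈ 14010` the tail must be bounded in the LOCAL scale — use
`|H_0(w)| ≤ A(w/2)‖ζ‖`-type envelopes from `stub_hardyLink`'s quantitative identity with an explicit
`|ζ(½+it)|` bound, `t ∈ [6950, 7060]`); expected `≈ 40–60` monotone `a`-boxes (relative width `≲ 9 %` at
`a = 32`, `20–30 %` below `20`) times `x`-subintervals, all reading ONE certified table of `Z(t)`,
`t ∈ [6975, 7035]`, to `~7` significant digits. -/
theorem stub_lehmerBox :
    ∀ a : ℝ, 1 ≤ a → a ≤ 32 → ∀ x ∈ Icc (14009.83 : ℝ) 14010.5,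
    0 < (deBruijnHDiv (fun u : ℝ => 1 + u ^ 2 / a ^ 2) (x : ℂ)).re := by
  sorry

/-! ## Consistency: each named statement IS its registered stub (definitionally) -/

theorem zeroFreeBracket_holds : ZeroFreeBracket := stub_zeroFreeBracket
theorem hardyLink_holds : HardyLink := stub_hardyLink
theorem lowSigns_holds : LowSigns := stub_lowSigns
theorem lowBox_holds : LowBox := stub_lowBox
theorem lehmerSigns_holds : LehmerSigns := stub_lehmerSigns
theorem lehmerBox_holds : LehmerBox := stub_lehmerBox

/-! ## Name-keyed aliases of the six statements — the hypotheses of `MediumKernelNoGo_of`. The native skeleton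
audit (`#h21_check_skeleton`) admits a hypothesis only if its head constant is a registered obligation or is NAMED
like a declared stub; `__Registered.stub_X` is statement `X` under the registered stub's short name (device of
`Cruxes/LoopsToCrossings/Lines/br-sandwich-diagonal.lean`; the `__` namespace is an implementation detail, so the
audit's stub report resolves each `stub_…` to the sorried theorem, not to its alias; the gate-reserved `@[stub]`
attribute is not written by a planner). -/
namespace __Registered

/-- Alias of `ZeroFreeBracket` keyed by the registered stub name. -/
abbrev stub_zeroFreeBracket : Prop := ZeroFreeBracket
/-- Alias of `HardyLink` keyed by the registered stub name. -/
abbrev stub_hardyLink : Prop := HardyLink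
/-- Alias of `LowSigns` keyed by the registered stub name. -/
abbrev stub_lowSigns : Prop := LowSigns
/-- Alias of `LowBox` keyed by the registered stub name. -/
abbrev stub_lowBox : Prop := LowBox
/-- Alias of `LehmerSigns` keyed by the registered stub name. -/
abbrev stub_lehmerSigns : Prop := LehmerSigns
/-- Alias of `LehmerBox` keyed by the registered stub name. -/
abbrev stub_lehmerBox : Prop := LehmerBox

end __Registered

/-! ## Glue (proved): signs of `H_0` from signs of `Z` -/

/-- From the link: `Z(t) < 0 ⇒ H_0(2t) > 0`. -/
theorem re_deBruijnH_pos_of_hardyZ_neg (hLink : HardyLink) {t : ℝ} (h : hardyZ t < 0) :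
    0 < (deBruijnH 0 ((2 * t : ℝ) : ℂ)).re := by
  obtain ⟨A, hA, hEq⟩ := hLink t
  rw [hEq]
  nlinarith [mul_neg_of_pos_of_neg hA h]

/-- From the link: `Z(t) > 0 ⇒ H_0(2t) < 0`. -/
theorem re_deBruijnH_neg_of_hardyZ_pos (hLink : HardyLink) {t : ℝ} (h : 0 < hardyZ t) :
    (deBruijnH 0 ((2 * t : ℝ) : ℂ)).re < 0 := by
  obtain ⟨A, hA, hEq⟩ := hLink t
  rw [hEq]
  nlinarith [mul_pos hA h]

/-- From the link: `Z(t) ≤ 0 ⇒ H_0(2t) ≥ 0`. -/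
theorem re_deBruijnH_nonneg_of_hardyZ_nonpos (hLink : HardyLink) {t : ℝ} (h : hardyZ t ≤ 0) :
    0 ≤ (deBruijnH 0 ((2 * t : ℝ) : ℂ)).re := by
  obtain ⟨A, hA, hEq⟩ := hLink t
  rw [hEq]
  nlinarith [mul_nonpos_of_nonneg_of_nonpos hA.le h]

/-- From the link: `Z(t) ≥ 0 ⇒ H_0(2t) ≤ 0`. -/
theorem re_deBruijnH_nonpos_of_hardyZ_nonneg (hLink : HardyLink) {t : ℝ} (h : 0 ≤ hardyZ t) :
    (deBruijnH 0 ((2 * t : ℝ) : ℂ)).re ≤ 0 := by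
  obtain ⟨A, hA, hEq⟩ := hLink t
  rw [hEq]
  nlinarith [mul_nonneg hA.le h]

/-! ## The composition: the six stubs imply the crux, BY NAME -/

/-- **`MediumKernelNoGo` from the six registered stubs** (pure logic; no `sorry`). For `a ∈ [π/8, 1]` the low
bracket `[221.9, 223.9]` (`σ = −1`: `F_a < 0` by `LowBox`, `H_0 < 0` at the ends and `H_0 ≥ 0` at `m = 2t`
by `LowSigns` through `HardyLink`) feeds the lever; for `a ∈ (1, 32]` the Lehmer bracket `[14009.83, 14010.5]`
(`σ = +1`) does. `0 < a` comes from `π/8 ≤ a` — the hypothesis Disproof.lean §2 shows to be load-bearing. -/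
theorem MediumKernelNoGo_of (hLever : __Registered.stub_zeroFreeBracket) (hLink : __Registered.stub_hardyLink)
    (hLowS : __Registered.stub_lowSigns) (hLowB : __Registered.stub_lowBox)
    (hLehS : __Registered.stub_lehmerSigns) (hLehB : __Registered.stub_lehmerBox) :
    Summit.RiemannHypothesis.RiemannHypothesis.Theses.UniversalFactor.MediumKernelNoGo := by
  intro a ha h32
  have hpi : 0 < Real.pi / 8 := by positivity
  have ha0 : 0 < a := lt_of_lt_of_le hpi ha
  show ¬ HasOnlyRealZeros (deBruijnHDiv fun u : ℝ => 1 + u ^ 2 / a ^ 2)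
  rcases le_or_gt a 1 with hle | hlt
  · -- low window: bracket [221.9, 223.9], σ = -1
    obtain ⟨hZc, hZd, t, htc, htd, hZt⟩ := hLowS
    have hc : (deBruijnH 0 ((221.9 : ℝ) : ℂ)).re < 0 := by
      have h := re_deBruijnH_neg_of_hardyZ_pos hLink hZc
      have e : (2 * 110.95 : ℝ) = 221.9 := by norm_num
      rwa [e] at h
    have hd : (deBruijnH 0 ((223.9 : ℝ) : ℂ)).re < 0 := by
      have h := re_deBruijnH_neg_of_hardyZ_pos hLink hZd
      have e : (2 * 111.95 : ℝ) = 223.9 := by norm_num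
      rwa [e] at h
    have hm : 0 ≤ (deBruijnH 0 ((2 * t : ℝ) : ℂ)).re := re_deBruijnH_nonneg_of_hardyZ_nonpos hLink hZt
    refine hLever a 221.9 (2 * t) 223.9 (-1) ha0 (by linarith) (by linarith) (Or.inr rfl) ?_ ?_ ?_ ?_
    · intro x hx
      have h := hLowB a ha hle x hx
      linarith
    · linarith
    · linarith
    · linarith
  · -- Lehmer window: bracket [14009.83, 14010.5], σ = 1
    obtain ⟨hZc, hZd, t, htc, htd, hZt⟩ := hLehS
    have hc : 0 < (deBruijnH 0 ((14009.83 : ℝ) : ℂ)).re := by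
      have h := re_deBruijnH_pos_of_hardyZ_neg hLink hZc
      have e : (2 * 7004.915 : ℝ) = 14009.83 := by norm_num
      rwa [e] at h
    have hd : 0 < (deBruijnH 0 ((14010.5 : ℝ) : ℂ)).re := by
      have h := re_deBruijnH_pos_of_hardyZ_neg hLink hZd
      have e : (2 * 7005.25 : ℝ) = 14010.5 := by norm_num
      rwa [e] at h
    have hm : (deBruijnH 0 ((2 * t : ℝ) : ℂ)).re ≤ 0 := re_deBruijnH_nonpos_of_hardyZ_nonneg hLink hZt
    refine hLever a 14009.83 (2 * t) 14010.5 1 ha0 (by linarith) (by linarith) (Or.inl rfl) ?_ ?_ ?_ ?_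
    · intro x hx
      have h := hLehB a hlt.le h32 x hx
      linarith
    · linarith
    · linarith
    · linarith

/-- Wiring check: the registered `stub_*` theorems feed `MediumKernelNoGo_of` exactly as stated (so replacing the
six `sorry`s by landed proofs closes the crux; this `example` is deliberately unnamed so that
`MediumKernelNoGo_of` stays the only theorem concluding the crux — unambiguous skeleton audit). -/
example : Summit.RiemannHypothesis.RiemannHypothesis.Theses.UniversalFactor.MediumKernelNoGo :=
  MediumKernelNoGo_of stub_zeroFreeBracket stub_hardyLink stub_lowSigns stub_lowBox stub_lehmerSigns
    stub_lehmerBox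

end Summit.RiemannHypothesis.RiemannHypothesis.Cruxes.MediumKernelNoGo.PencilBracketCount
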